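import Summits.CriticalPhenomena.PercolationContinuityZ3.Theorems.PercNearOneGluingNoHeavyLowerTailSahiThreeCopyProducts
import Summits.CriticalPhenomena.PercolationContinuityZ3.Theorems.PercNearOneGluingNoHeavyLowerTailSahiThreeCopyBernstein

/-!
# `NoHeavyLowerTail` (crux stmt-CriticalPhenomena-4575), Sahi programme: **3C-SAHI HOLDS FOR EVERY TRIPLE OF OR-EVENTS**
# (equivalently: the THREE-CYLINDER SANDWICH `c_b(ū,v̄,w̄) ≤ H_b(ū,v̄) + H_b(ū,w̄) + H_b(v̄,w̄)` for down-cylinders)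

Support file (Sahi cell, seat `prim-sahi-p1`, generation 54; `--supports stmt-CriticalPhenomena-4575`); companion of `…SahiThreeCopy`,
`…SahiThreeCopyNested` (complement identity `tc_compl`), `…SahiThreeCopyCylinder` (`cprod`), `…SahiThreeCopyProducts` (the factorisation
`N3_cprod_cprod_cprod`).  Pure proofs plus bookkeeping definitions; no `sorry`, standard axioms.

THE THEOREM (`tc_orInd_nonneg`, memo FROM-prim-sahi-p1-gen53-THREE-COPY §9, there numerically certified; here PROVED for every `d`, every
profile `b`): for `S, T, U ⊆ [d]` let `A = {x : ∃ i ∈ S, x_i = 1}`, `B = {x : ∃ i ∈ T, x_i = 1}`, `C = {x : ∃ i ∈ U, x_i = 1}` (OR-events; up-sets).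
Then the three-copy Sahi coefficient of `…SahiThreeCopy` satisfies `c_b(1_A, 1_B, 1_C) ≥ 0`.  This is the census conjecture 3C-SAHI
(`ThreeCopySahi`, CENSUS §175 / W197) on the class where the adversarial searches of generation 53 (kit j325128/j325129/j325466, d = 5, 6, 7,
1.4·10⁸ evaluations of the unsettled class) found the TIGHTEST margins (all-but-one OR families); summed against the Bernstein weights it
gives `E₃^{coin q}(1_A,1_B,1_C) ≥ 0` for every product measure (`sahiE_three_coin_orInd_nonneg`).

THE PROOF.  `1_A = 1 − ū_S` with the DOWN-CYLINDER `ū_S(x) = Π_{i ∈ S}(1 − x_i)` (`dcyl S`, a coordinate product `cprod 1 (−1_S)`).  By the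
complement identity (`tc_compl`) the claim is the SANDWICH `c_b(ū_S, ū_T, ū_U) ≤ H_b(ū_S,ū_T) + H_b(ū_S,ū_U) + H_b(ū_T,ū_U)`
(`tc_dcyl_le_sum_harris`), `H_b(u,v) = N_b(uv;1;1) − N_b(u;v;1)`.  Products of down-cylinders are down-cylinders of unions, so the eleven
`N_b`-terms are `N_b` of three down-cylinders, which FACTORISE over the coordinates (`N3_cprod_cprod_cprod`); the factor of coordinate `i`
is `C(3 − r_i, b_i)`, `r_i` = number of copies whose cylinder contains `i` (`locN3_one_neg`), = `C(3,b_i)·φ_{r_i}(b_i)` with the table `phi`.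
Grouping the coordinates by their Venn pattern with respect to `(S,T,U)` (`pat`, `RV`, `prod_fiberwise`) every term becomes
`Z_b ·` a monomial in twelve REGION PRODUCTS `α, β, γ` (one set), `P ≥ p`, `Q ≥ q`, `R ≥ r` (two sets; `φ₁`- and `φ₂`-products),
`M, m, e` (all three; `φ₁, φ₂, φ₃`), and `[ΣH_b − c_b]/Z_b = PQRM·σ − m(αβ·pQR + αγ·PqR + βγ·PQr) + αβγ·m(pqR + pQr + Pqr) − αβγ·pqr·e`,
`σ = αβ + αγ + βγ − 2αβγ`.  The real inequality (`threeCylinder_key_ineq`) is proved DIVISION-FREE by the explicit certificate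
`Φ = M[(σPQR − K) + (1 − M)K] + (M² − m)(K₁ − αβγK₂) + αβγ·pqr·(M² − e)`, each bracket a sum of products of the nonnegative quantities
`α, β, γ, 1−α, 1−β, 1−γ, p, q, r, P−p, Q−q, R−r, M, 1−M, M²−m, M²−e` (termwise `φ₁ ≤ 1`, `φ₂ ≤ φ₁`, `φ₂ ≤ φ₁²`, `φ₃ ≤ φ₁²`).
Identity and certificate were checked symbolically and against brute force (folder code/cert_check.py) before typing.
[this work; conjecture and objects: CENSUS §175 W197 (prim-sahi-census gen 54); paper proof: memo FROM-prim-sahi-p1-gen53 §9]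
-/

namespace Summit.CriticalPhenomena.PercolationContinuityZ3.Theorems.SahiThreeCopy

open Finset Function Literature.Combinatorics.Sahi2008
open scoped BigOperators

noncomputable section

variable {d : ℕ}

/-! ### §1 Down-cylinders and OR-events -/

/-- The coefficient vector `−1_S`. [this work] -/
def negInd (S : Finset (Fin d)) : Fin d → ℝ := fun i => if i ∈ S then -1 else 0

/-- The DOWN-CYLINDER `ū_S(x) = Π_{i ∈ S}(1 − x_i)`, the indicator of `{x : x_i = 0 ∀ i ∈ S}`, as a coordinate product. [this work] -/
def dcyl (S : Finset (Fin d)) : Pt d → ℝ := cprod (fun _ => 1) (negInd S)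

/-- `ū_S` is the indicator of `{x : x_i = 0 ∀ i ∈ S}`. [this work] -/
theorem dcyl_apply (S : Finset (Fin d)) (x : Pt d) : dcyl S x = if ∀ i ∈ S, x i = false then 1 else 0 := by
  unfold dcyl cprod negInd
  by_cases h : ∀ i ∈ S, x i = false
  · rw [if_pos h]
    refine prod_eq_one fun i _ => ?_
    by_cases hi : i ∈ S
    · simp [h i hi]
    · simp [hi]
  · rw [if_neg h]
    push Not at h
    obtain ⟨i, hi, hx⟩ := h
    refine prod_eq_zero (mem_univ i) ?_
    have hx' : x i = true := by cases hxi : x i <;> simp_all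
    simp [hi, hx']

/-- `ū_S ≥ 0`. [this work] -/
theorem dcyl_nonneg (S : Finset (Fin d)) (x : Pt d) : 0 ≤ dcyl S x := by
  rw [dcyl_apply]; split_ifs <;> norm_num

/-- `ū_S ≤ 1`. [this work] -/
theorem dcyl_le_one (S : Finset (Fin d)) (x : Pt d) : dcyl S x ≤ 1 := by
  rw [dcyl_apply]; split_ifs <;> norm_num

/-- Products of down-cylinders: `ū_S · ū_T = ū_{S ∪ T}`. [this work] -/
theorem dcyl_mul (S T : Finset (Fin d)) : dcyl S * dcyl T = dcyl (S ∪ T) := by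
  funext x
  simp only [Pi.mul_apply, dcyl_apply]
  by_cases hS : ∀ i ∈ S, x i = false
  · by_cases hT : ∀ i ∈ T, x i = false
    · rw [if_pos hS, if_pos hT, if_pos (forall_mem_union.2 ⟨hS, hT⟩)]; ring
    · rw [if_neg hT, if_neg (fun h => hT (forall_mem_union.1 h).2)]; ring
  · rw [if_neg hS, if_neg (fun h => hS (forall_mem_union.1 h).1)]; ring

/-- The empty down-cylinder is the constant `1`. [this work] -/
theorem dcyl_empty : dcyl (∅ : Finset (Fin d)) = 1 := by
  funext x; simp [dcyl_apply]

/-- The indicator of the OR-EVENT `A_S = {x : ∃ i ∈ S, x_i = 1}` (an up-set; `A_∅ = ∅`). [this work] -/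
def orInd (S : Finset (Fin d)) : Pt d → ℝ := fun x => if ∃ i ∈ S, x i = true then 1 else 0

/-- `1_{A_S} = 1 − ū_S`. [this work] -/
theorem orInd_eq_one_sub_dcyl (S : Finset (Fin d)) : orInd S = 1 - dcyl S := by
  funext x
  simp only [orInd, Pi.sub_apply, Pi.one_apply, dcyl_apply]
  by_cases h : ∃ i ∈ S, x i = true
  · have h' : ¬ ∀ i ∈ S, x i = false := by
      push Not; obtain ⟨i, hi, hx⟩ := h; exact ⟨i, hi, by simp [hx]⟩
    rw [if_pos h, if_neg h']; norm_num
  · have h' : ∀ i ∈ S, x i = false := by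
      intro i hi; push Not at h; simpa using h i hi
    rw [if_neg h, if_pos h']; norm_num

/-- `1_{A_S}` is the indicator of the finite set `{x : ∃ i ∈ S, x_i = 1}`. [this work] -/
theorem orInd_eq_setInd (S : Finset (Fin d)) : orInd S = setInd (univ.filter fun x : Pt d => ∃ i ∈ S, x i = true) := by
  funext x; simp [orInd, setInd]

/-- The OR-event is an up-set. [this work] -/
theorem isUpperSet_orSet (S : Finset (Fin d)) :
    IsUpperSet ((univ.filter fun x : Pt d => ∃ i ∈ S, x i = true : Finset (Pt d)) : Set (Pt d)) := by
  intro x y hxy hx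
  simp only [coe_filter, mem_univ, true_and, Set.mem_setOf_eq] at hx ⊢
  obtain ⟨i, hi, hxi⟩ := hx
  exact ⟨i, hi, Bool.eq_true_of_true_le (hxi ▸ hxy i)⟩

/-- `1_{A_S} ≥ 0`. [this work] -/
theorem orInd_nonneg (S : Finset (Fin d)) (x : Pt d) : 0 ≤ orInd S x := by
  rw [orInd_eq_setInd]; exact setInd_nonneg _ x

/-- `1_{A_S}` is monotone. [this work] -/
theorem monotone_orInd (S : Finset (Fin d)) : Monotone (orInd S) := by
  rw [orInd_eq_setInd]; exact monotone_setInd (isUpperSet_orSet S)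

/-! ### §2 The local factors `C(3−r,k) = C(3,k)·φ_r(k)` -/

/-- The normalised local factor table `φ_r(k) = C(3−r,k)/C(3,k)` (`φ_0 ≡ 1`; `0` off the support). [this work] -/
def phi (r k : ℕ) : ℝ :=
  if r = 0 then 1
  else if r = 1 then (if k = 0 then 1 else if k = 1 then 2 / 3 else if k = 2 then 1 / 3 else 0)
  else if r = 2 then (if k = 0 then 1 else if k = 1 then 1 / 3 else 0)
  else if r = 3 then (if k = 0 then 1 else 0)
  else 0

/-- `φ_0 ≡ 1`. [this work] -/
@[simp] theorem phi_zero (k : ℕ) : phi 0 k = 1 := by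
  simp [phi]

/-- `φ ≥ 0`. [this work] -/
theorem phi_nonneg (r k : ℕ) : 0 ≤ phi r k := by
  unfold phi; split_ifs <;> norm_num

/-- `φ_1 ≤ 1`. [this work] -/
theorem phi_one_le_one (k : ℕ) : phi 1 k ≤ 1 := by
  unfold phi; split_ifs <;> norm_num

/-- `φ_2 ≤ φ_1`. [this work] -/
theorem phi_two_le_one (k : ℕ) : phi 2 k ≤ phi 1 k := by
  rcases Nat.lt_or_ge k 3 with hk | hk
  · interval_cases k <;> norm_num [phi]
  · have h0 : k ≠ 0 := by omega
    have h1 : k ≠ 1 := by omega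
    have h2 : k ≠ 2 := by omega
    simp [phi, h0, h1, h2]

/-- `φ_2 ≤ φ_1²`. [this work] -/
theorem phi_two_le_sq (k : ℕ) : phi 2 k ≤ phi 1 k ^ 2 := by
  rcases Nat.lt_or_ge k 3 with hk | hk
  · interval_cases k <;> norm_num [phi]
  · have h0 : k ≠ 0 := by omega
    have h1 : k ≠ 1 := by omega
    have h2 : k ≠ 2 := by omega
    simp [phi, h0, h1, h2]

/-- `φ_3 ≤ φ_1²`. [this work] -/
theorem phi_three_le_sq (k : ℕ) : phi 3 k ≤ phi 1 k ^ 2 := by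
  rcases Nat.lt_or_ge k 3 with hk | hk
  · interval_cases k <;> norm_num [phi]
  · have h0 : k ≠ 0 := by omega
    have h1 : k ≠ 1 := by omega
    have h2 : k ≠ 2 := by omega
    simp [phi, h0, h1, h2]

/-- One-coordinate sums with no arrangement vanish (`k ≥ 4`). [this work] -/
theorem locN3_eq_zero_of_four_le {k : ℕ} (hk : 4 ≤ k) (α β α' β' α'' β'' : ℝ) : locN3 k α β α' β' α'' β'' = 0 := by
  unfold locN3
  refine sum_eq_zero fun x _ => sum_eq_zero fun y _ => sum_eq_zero fun z _ => ?_
  have : x.toNat + y.toNat + z.toNat ≠ k := by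
    have := Bool.toNat_le x; have := Bool.toNat_le y; have := Bool.toNat_le z; omega
  rw [if_neg this]

/-- **The local count**: on one coordinate required (`β = −1`, i.e. factor `1 − x`) by `r` of the three copies, the one-coordinate three-copy
sum at profile value `k` is `#{(x,y,z) ∈ {0,1}³ : x+y+z = k, required copies at 0} = C(3−r,k) = C(3,k)·φ_r(k)`. [this work] -/
theorem locN3_one_neg (k : ℕ) (c₁ c₂ c₃ : Bool) :
    locN3 k 1 (if c₁ then -1 else 0) 1 (if c₂ then -1 else 0) 1 (if c₃ then -1 else 0) =
      (Nat.choose 3 k : ℝ) * phi (c₁.toNat + c₂.toNat + c₃.toNat) k := by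
  rcases Nat.lt_or_ge k 4 with hk | hk
  · interval_cases k <;> cases c₁ <;> cases c₂ <;> cases c₃ <;>
      simp only [locN3, Fintype.sum_bool] <;> norm_num [phi, Nat.choose]
  · rw [locN3_eq_zero_of_four_le hk, Nat.choose_eq_zero_of_lt (by omega : 3 < k)]
    simp

/-! ### §3 `N_b` of three down-cylinders: factorisation and grouping by Venn pattern -/

/-- `Z_b = Π_i C(3,b_i)` = the number of arrangements of the profile `b` (`= N_b(1;1;1)`). [this work] -/
def Zb (b : Fin d → ℕ) : ℝ := ∏ i, (Nat.choose 3 (b i) : ℝ)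

/-- `Z_b ≥ 0`. [this work] -/
theorem Zb_nonneg (b : Fin d → ℕ) : 0 ≤ Zb b := prod_nonneg fun _ _ => Nat.cast_nonneg _

/-- The VENN PATTERN of the coordinate `i` with respect to `(S,T,U)`. [this work] -/
def pat (S T U : Finset (Fin d)) (i : Fin d) : Bool × Bool × Bool := (decide (i ∈ S), decide (i ∈ T), decide (i ∈ U))

/-- The set of coordinates whose Venn pattern satisfies the Boolean predicate `π` (e.g. `π = fst` gives `S`, `π ϖ = ϖ.1 || ϖ.2.1` gives `S ∪ T`).
[this work] -/
def cset (S T U : Finset (Fin d)) (π : Bool × Bool × Bool → Bool) : Finset (Fin d) := univ.filter fun i => π (pat S T U i) = true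

/-- The REGION PRODUCT `RV_ϖ(r) = Π_{i : pat i = ϖ} φ_r(b_i)`. [this work] -/
def RV (b : Fin d → ℕ) (S T U : Finset (Fin d)) (ϖ : Bool × Bool × Bool) (r : ℕ) : ℝ :=
  ∏ i ∈ univ.filter (fun i => pat S T U i = ϖ), phi r (b i)

/-- `RV_ϖ(0) = 1`. [this work] -/
@[simp] theorem RV_zero (b : Fin d → ℕ) (S T U : Finset (Fin d)) (ϖ : Bool × Bool × Bool) : RV b S T U ϖ 0 = 1 :=
  prod_eq_one fun _ _ => phi_zero _

/-- `RV ≥ 0`. [this work] -/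
theorem RV_nonneg (b : Fin d → ℕ) (S T U : Finset (Fin d)) (ϖ : Bool × Bool × Bool) (r : ℕ) : 0 ≤ RV b S T U ϖ r :=
  prod_nonneg fun _ _ => phi_nonneg _ _

/-- `RV_ϖ(1) ≤ 1`. [this work] -/
theorem RV_one_le_one (b : Fin d → ℕ) (S T U : Finset (Fin d)) (ϖ : Bool × Bool × Bool) : RV b S T U ϖ 1 ≤ 1 :=
  prod_le_one (fun _ _ => phi_nonneg _ _) fun _ _ => phi_one_le_one _

/-- `RV_ϖ(2) ≤ RV_ϖ(1)`. [this work] -/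
theorem RV_two_le_one (b : Fin d → ℕ) (S T U : Finset (Fin d)) (ϖ : Bool × Bool × Bool) : RV b S T U ϖ 2 ≤ RV b S T U ϖ 1 :=
  prod_le_prod (fun _ _ => phi_nonneg _ _) fun _ _ => phi_two_le_one _

/-- `RV_ϖ(2) ≤ RV_ϖ(1)²`. [this work] -/
theorem RV_two_le_sq (b : Fin d → ℕ) (S T U : Finset (Fin d)) (ϖ : Bool × Bool × Bool) : RV b S T U ϖ 2 ≤ RV b S T U ϖ 1 ^ 2 := by
  unfold RV
  rw [← prod_pow]
  exact prod_le_prod (fun _ _ => phi_nonneg _ _) fun _ _ => phi_two_le_sq _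

/-- `RV_ϖ(3) ≤ RV_ϖ(1)²`. [this work] -/
theorem RV_three_le_sq (b : Fin d → ℕ) (S T U : Finset (Fin d)) (ϖ : Bool × Bool × Bool) : RV b S T U ϖ 3 ≤ RV b S T U ϖ 1 ^ 2 := by
  unfold RV
  rw [← prod_pow]
  exact prod_le_prod (fun _ _ => phi_nonneg _ _) fun _ _ => phi_three_le_sq _

/-- The coefficient vector of a pattern set. [this work] -/
theorem negInd_cset (S T U : Finset (Fin d)) (π : Bool × Bool × Bool → Bool) :
    negInd (cset S T U π) = fun i => if π (pat S T U i) then -1 else 0 := by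
  funext i; simp [negInd, cset]

/-- `S`, `T`, `U` as pattern sets. [this work] -/
theorem cset_fst (S T U : Finset (Fin d)) : cset S T U (fun ϖ => ϖ.1) = S := by
  ext i; simp [cset, pat]

/-- See `cset_fst`. [this work] -/
theorem cset_snd (S T U : Finset (Fin d)) : cset S T U (fun ϖ => ϖ.2.1) = T := by
  ext i; simp [cset, pat]

/-- See `cset_fst`. [this work] -/
theorem cset_thd (S T U : Finset (Fin d)) : cset S T U (fun ϖ => ϖ.2.2) = U := by
  ext i; simp [cset, pat]

/-- Products of pattern down-cylinders: disjunction of the predicates. [this work] -/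
theorem dcyl_cset_mul (S T U : Finset (Fin d)) (π π' : Bool × Bool × Bool → Bool) :
    dcyl (cset S T U π) * dcyl (cset S T U π') = dcyl (cset S T U fun ϖ => π ϖ || π' ϖ) := by
  rw [dcyl_mul]
  congr 1
  ext i; simp [cset, Bool.or_eq_true]

/-- The trivially-false predicate gives the constant `1`. [this work] -/
theorem dcyl_cset_false (S T U : Finset (Fin d)) : dcyl (cset S T U fun _ => false) = 1 := by
  have : cset S T U (fun _ => false) = ∅ := by ext i; simp [cset]
  rw [this, dcyl_empty]

/-- ★ **`N_b` of three pattern down-cylinders** = `Z_b · Π_ϖ RV_ϖ(r_ϖ)`, `r_ϖ` = number of the three predicates holding at the pattern `ϖ`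
(factorisation over coordinates, local count, grouping by pattern). [this work] -/
theorem N3_dcyl_cset (b : Fin d → ℕ) (S T U : Finset (Fin d)) (π₁ π₂ π₃ : Bool × Bool × Bool → Bool) :
    N3 b (dcyl (cset S T U π₁)) (dcyl (cset S T U π₂)) (dcyl (cset S T U π₃)) =
      Zb b * ∏ ϖ, RV b S T U ϖ ((π₁ ϖ).toNat + (π₂ ϖ).toNat + (π₃ ϖ).toNat) := by
  unfold dcyl Zb
  rw [negInd_cset, negInd_cset, negInd_cset, N3_cprod_cprod_cprod]
  simp only [locN3_one_neg]
  rw [prod_mul_distrib]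
  congr 1
  rw [← prod_fiberwise univ (pat S T U)
    (fun i => phi ((π₁ (pat S T U i)).toNat + (π₂ (pat S T U i)).toNat + (π₃ (pat S T U i)).toNat) (b i))]
  refine prod_congr rfl fun ϖ _ => ?_
  unfold RV
  refine prod_congr rfl fun i hi => ?_
  rw [(mem_filter.1 hi).2]

/-! ### §4 The real inequality (division-free certificate) -/

/-- ★ **The key real inequality** behind the three-cylinder sandwich: for `α, β, γ, M ∈ [0,1]`, `0 ≤ p ≤ P`, `0 ≤ q ≤ Q`, `0 ≤ r ≤ R`,
`m ≤ M²`, `e ≤ M²`: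
`0 ≤ PQRM(αβ+αγ+βγ−2αβγ) − m(αβ·pQR + αγ·PqR + βγ·PQr) + αβγ·m(pqR + pQr + Pqr) − αβγ·pqr·e`.
Certificate: `= M[X + (1−M)(K' + αβγpqr)] + (M²−m)K' + αβγpqr(M²−e)` with
`X = αβ(1−γ)(P−p)QR + αγ(1−β)P(Q−q)R + βγ(1−α)PQ(R−r) + αβγ(P−p)(Q−q)(R−r)`,
`K' = αβpQ((R−r)+(1−γ)r) + αγqR((P−p)+(1−β)p) + βγPr((Q−q)+(1−α)q)`. [this work] -/
theorem threeCylinder_key_ineq {α β γ P p Q q R r M m e : ℝ} (hα : 0 ≤ α) (hα1 : α ≤ 1) (hβ : 0 ≤ β) (hβ1 : β ≤ 1)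
    (hγ : 0 ≤ γ) (hγ1 : γ ≤ 1) (hp : 0 ≤ p) (hpP : p ≤ P) (hq : 0 ≤ q) (hqQ : q ≤ Q) (hr : 0 ≤ r) (hrR : r ≤ R)
    (hM : 0 ≤ M) (hM1 : M ≤ 1) (hm : m ≤ M ^ 2) (he : e ≤ M ^ 2) :
    0 ≤ P * Q * R * M * (α * β + α * γ + β * γ - 2 * α * β * γ) - m * (α * β * p * Q * R + α * γ * P * q * R + β * γ * P * Q * r) +
      α * β * γ * m * (p * q * R + p * Q * r + P * q * r) - α * β * γ * p * q * r * e := by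
  have hP : 0 ≤ P := hp.trans hpP
  have hQ : 0 ≤ Q := hq.trans hqQ
  have hR : 0 ≤ R := hr.trans hrR
  have a1 : 0 ≤ 1 - α := sub_nonneg.2 hα1
  have b1 : 0 ≤ 1 - β := sub_nonneg.2 hβ1
  have c1 : 0 ≤ 1 - γ := sub_nonneg.2 hγ1
  have M1 : 0 ≤ 1 - M := sub_nonneg.2 hM1
  have dP : 0 ≤ P - p := sub_nonneg.2 hpP
  have dQ : 0 ≤ Q - q := sub_nonneg.2 hqQ
  have dR : 0 ≤ R - r := sub_nonneg.2 hrR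
  have dm : 0 ≤ M ^ 2 - m := sub_nonneg.2 hm
  have de : 0 ≤ M ^ 2 - e := sub_nonneg.2 he
  have hX : 0 ≤ α * β * (1 - γ) * (P - p) * Q * R + α * γ * (1 - β) * P * (Q - q) * R + β * γ * (1 - α) * P * Q * (R - r) +
      α * β * γ * (P - p) * (Q - q) * (R - r) := by positivity
  have hK : 0 ≤ α * β * p * Q * ((R - r) + (1 - γ) * r) + α * γ * q * R * ((P - p) + (1 - β) * p) +
      β * γ * P * r * ((Q - q) + (1 - α) * q) := by positivity
  have h3 : 0 ≤ α * β * γ * p * q * r := by positivity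
  have t1 : 0 ≤ M * ((α * β * (1 - γ) * (P - p) * Q * R + α * γ * (1 - β) * P * (Q - q) * R + β * γ * (1 - α) * P * Q * (R - r) +
      α * β * γ * (P - p) * (Q - q) * (R - r)) + (1 - M) * ((α * β * p * Q * ((R - r) + (1 - γ) * r) +
      α * γ * q * R * ((P - p) + (1 - β) * p) + β * γ * P * r * ((Q - q) + (1 - α) * q)) + α * β * γ * p * q * r)) :=
    mul_nonneg hM (add_nonneg hX (mul_nonneg M1 (add_nonneg hK h3)))
  have t2 : 0 ≤ (M ^ 2 - m) * (α * β * p * Q * ((R - r) + (1 - γ) * r) + α * γ * q * R * ((P - p) + (1 - β) * p) +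
      β * γ * P * r * ((Q - q) + (1 - α) * q)) := mul_nonneg dm hK
  have t3 : 0 ≤ α * β * γ * p * q * r * (M ^ 2 - e) := mul_nonneg h3 de
  nlinarith [t1, t2, t3]

/-! ### §5 The three-cylinder sandwich and 3C-SAHI for OR-events -/

/-- ★★ **The three-cylinder sandwich** (down-cylinders, every profile): for all `S, T, U ⊆ [d]` and every `b`,
`c_b(ū_S, ū_T, ū_U) ≤ [N_b(ū_Sū_T;1;1) − N_b(ū_S;ū_T;1)] + [N_b(ū_Sū_U;1;1) − N_b(ū_S;ū_U;1)] + [N_b(ū_Tū_U;1;1) − N_b(ū_T;ū_U;1)]` —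
the spectator Harris gaps in `c_b` never exceed the three pairwise three-copy Harris gaps. [this work; memo FROM-prim-sahi-p1-gen53 §9] -/
theorem tc_dcyl_le_sum_harris (b : Fin d → ℕ) (S T U : Finset (Fin d)) :
    tc b (dcyl S) (dcyl T) (dcyl U) ≤
      (N3 b (dcyl S * dcyl T) 1 1 - N3 b (dcyl S) (dcyl T) 1) + (N3 b (dcyl S * dcyl U) 1 1 - N3 b (dcyl S) (dcyl U) 1) +
        (N3 b (dcyl T * dcyl U) 1 1 - N3 b (dcyl T) (dcyl U) 1) := by
  suffices H : ∀ S' T' U' : Finset (Fin d), S' = cset S T U (fun ϖ => ϖ.1) → T' = cset S T U (fun ϖ => ϖ.2.1) →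
      U' = cset S T U (fun ϖ => ϖ.2.2) →
      tc b (dcyl S') (dcyl T') (dcyl U') ≤
        (N3 b (dcyl S' * dcyl T') 1 1 - N3 b (dcyl S') (dcyl T') 1) + (N3 b (dcyl S' * dcyl U') 1 1 - N3 b (dcyl S') (dcyl U') 1) +
          (N3 b (dcyl T' * dcyl U') 1 1 - N3 b (dcyl T') (dcyl U') 1) from
    H S T U (cset_fst S T U).symm (cset_snd S T U).symm (cset_thd S T U).symm
  intro S' T' U' hS hT hU
  subst hS hT hU
  unfold tc
  simp only [dcyl_cset_mul]
  rw [← dcyl_cset_false S T U]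
  simp only [N3_dcyl_cset, Fintype.prod_prod_type, Fintype.prod_bool, Bool.toNat_true, Bool.toNat_false, Bool.or_true,
    Bool.or_false, Nat.reduceAdd, add_zero, zero_add, RV_zero, mul_one]
  have hZ := Zb_nonneg b
  have key := threeCylinder_key_ineq
    (RV_nonneg b S T U (true, false, false) 1) (RV_one_le_one b S T U (true, false, false))
    (RV_nonneg b S T U (false, true, false) 1) (RV_one_le_one b S T U (false, true, false))
    (RV_nonneg b S T U (false, false, true) 1) (RV_one_le_one b S T U (false, false, true))
    (RV_nonneg b S T U (true, true, false) 2) (RV_two_le_one b S T U (true, true, false))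
    (RV_nonneg b S T U (true, false, true) 2) (RV_two_le_one b S T U (true, false, true))
    (RV_nonneg b S T U (false, true, true) 2) (RV_two_le_one b S T U (false, true, true))
    (RV_nonneg b S T U (true, true, true) 1) (RV_one_le_one b S T U (true, true, true))
    (RV_two_le_sq b S T U (true, true, true)) (RV_three_le_sq b S T U (true, true, true))
  nlinarith [mul_nonneg hZ key]

/-- ★★ **3C-SAHI FOR EVERY TRIPLE OF OR-EVENTS** (coefficientwise, every `d`, every profile): for `S, T, U ⊆ [d]`,
`0 ≤ c_b(1_{A_S}, 1_{A_T}, 1_{A_U})`, `A_S = {x ∈ {0,1}^d : ∃ i ∈ S, x_i = 1}`.  (Complement identity + the three-cylinder sandwich.)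
[this work; conjecture: CENSUS §175 W197; this class: memo FROM-prim-sahi-p1-gen53 §8–9 (adversarially tightest)] -/
theorem tc_orInd_nonneg (b : Fin d → ℕ) (S T U : Finset (Fin d)) : 0 ≤ tc b (orInd S) (orInd T) (orInd U) := by
  rw [orInd_eq_one_sub_dcyl, orInd_eq_one_sub_dcyl, orInd_eq_one_sub_dcyl, tc_compl]
  have := tc_dcyl_le_sum_harris b S T U
  linarith

/-- Events form: `0 ≤ c_b(1_A, 1_B, 1_C)` for the OR-events `A, B, C` of `S, T, U` as finite sets of points. [this work] -/
theorem tc_setInd_orSet_nonneg (b : Fin d → ℕ) (S T U : Finset (Fin d)) :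
    0 ≤ tc b (setInd (univ.filter fun x : Pt d => ∃ i ∈ S, x i = true))
      (setInd (univ.filter fun x : Pt d => ∃ i ∈ T, x i = true)) (setInd (univ.filter fun x : Pt d => ∃ i ∈ U, x i = true)) := by
  rw [← orInd_eq_setInd, ← orInd_eq_setInd, ← orInd_eq_setInd]
  exact tc_orInd_nonneg b S T U

/-- **Law level**: for every product ("coin") weight `q ∈ [0,1]^d` and all `S, T, U ⊆ [d]`, Sahi's third functional of the three OR-events is
nonnegative: `0 ≤ E₃^{coin q}(1_{A_S}, 1_{A_T}, 1_{A_U})` (sum the nonnegative tensor-Bernstein coefficients). [this work] -/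
theorem sahiE_three_coin_orInd_nonneg {q : Fin d → ℝ} (hq : ∀ i, 0 ≤ q i ∧ q i ≤ 1) (S T U : Finset (Fin d)) :
    0 ≤ sahiE (coinWeight q) 3 ![orInd S, orInd T, orInd U] :=
  sahiE_three_coin_nonneg_of_tc hq fun b => tc_orInd_nonneg b S T U

end

end Summit.CriticalPhenomena.PercolationContinuityZ3.Theorems.SahiThreeCopy
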